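import Summits.ResolutionOfSingularities.ResolutionOfSingularities.Theorems.FrobeniusClosingPatchingRelPerfectDepthSepCJSState
import HarnessLib

/-!
# Crux `PatchingRelPerfect` (stmt-ResolutionOfSingularities-16161), chain W5.2 — F6 STAGE 2, target T6-E2 `SeparationBoundary₃`,
# PHASE A: the SINGLE-PIECE STEP, output side — the new state, supports, the boundary cover, and the centre data of disjoint pieces

[OURS · L1 W5.2 · TargetsF6 T6-E2 Phase A] Fact-free; NOT statements of the manuscript under review (Hironaka 2017); format-free.
The weight-ONE port of T5-E's `…DepthWeightTwoBPieceStepOut` (res-D-pv-054) for the non-reduced host of Phase A: given the transport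
state `SepCJS.StateA 𝔟 H ℬ 𝒟`, the centre data `SepCJS.CentreA 𝔟 H ℬ Z` of ONE irreducible piece `Z = cl{η}`, a blowing up `τ`
along `𝓘(Z)` and the generic host order `m = ord_η H`:
* `fac'` — the new factorisation `τᶜ(𝔟, 1) = τᶜ(H, m) · monomialIdeal ℬ'`, `ℬ' = strict transforms ++ [(𝓘(Z)𝒪, m + w − 1)]`
  (`WeightTwoB.comap_host_mul_monomialIdeal` at `ν = 1`);
* `stateA'` — the new `StateA` (regularity of the blown-up scheme, the host's controlled transform an effective Cartier divisor
  (res-D-pv-026's (L-A)), snc / irreducibility / freeness of the new traces exactly as in T5-E, positivity of the new multiplicity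
  from ORD2 at the generic point (`StateA.one_le_newExp`), the format's boundary law);
* `support_host'` — `Supp τᶜ(H, m) = cl τ⁻¹(Supp H ∖ Z)` ((L-A)); `cover'` — a point over a born trace or over `Z` lies on a new
  trace (the E-side half of CJS's boundary law `B_{j+1} = τ⁻¹(B_j ∪ D_j)`, needed to read ORD2 at later centres);
* `CentreA.transport` — the centre data of a DISJOINT piece `Z₂` survive on `τ⁻¹Z₂`, ORD2 included (orders of controlled
  transforms off the centre, `IsBlowup.idealOrder_controlledTransform_of_not_mem`).

AI-written; AI review is weaker than expert review.

## References
* E. Bierstone, D. Grigoriev, P. Milman, J. Włodarczyk, arXiv:1206.3090, Def. 3.1.3, §3.2 Lemma 3.2.1, §4 Step 2, Lemma 8.0.3.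
  [BierstoneGrigorievMilmanWlodarczyk2011]
* V. Cossart, U. Jannsen, S. Saito, LNM 2270 (2020), Thm. 1.4, Def. 4.1, (6.2), Thm. 6.9 (a). [CossartJannsenSaito2020]
* J. Kollár, *Lectures on Resolution of Singularities* (2007), Def. 3.25, 3.30.2, (3.111) Step 1. [Kollar2007]
* U. Görtz, T. Wedhorn, *Algebraic Geometry I* (2nd ed. 2020), Prop. 13.91. [GortzWedhorn2020]
-/

-- `Summit.<Summit>.<Sub>.Theorems` with `Sub = Summit` (single-conjunct summit, D-0017)
set_option linter.dupNamespace false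

noncomputable section

open CategoryTheory CategoryTheory.Limits AlgebraicGeometry TopologicalSpace IsLocalRing
open Literature.AlgebraicGeometry.Resolution Scheme.IdealSheafData
open Literature.AlgebraicGeometry.Hironaka2017.S16Proof
open Literature.AlgebraicGeometry.Hironaka2017.MonomialPart Literature.AlgebraicGeometry.Hironaka2017.MonomialComponent

namespace Summit.ResolutionOfSingularities.ResolutionOfSingularities.Theorems

universe u

namespace SepCJS

open DepthSNC WeightTwoB

variable {W : Scheme.{u}}

section Step

variable [IsLocallyNoetherian W] {𝔟 H : W.IdealSheafData} {ℬ 𝒟 : List (W.IdealSheafData × ℕ)} {Z : Closeds W} {η : W}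
  {W' : Scheme.{u}} {τ : W' ⟶ W} {m : ℕ}

/-! ## The host side of the step -/

/-- The piece has empty interior (it lies on the hypersurface `Supp H`). [folklore] -/
theorem interior_piece_eq_empty (S : StateA 𝔟 H ℬ 𝒟) (Γ : CentreA 𝔟 H ℬ Z) (hη : IsGenericPoint η (Z : Set W)) :
    interior (Z : Set W) = ∅ := by
  have P := S.pieceIn Γ hη
  have h := interior_eq_empty_of_isGenericPoint_of_mem_support P.gen' P.hostCartier (P.subZ P.η_mem)
  rwa [PieceIn.support_eq (Z := Z)] at h

/-- The exceptional divisor is irreducible. [cite: GortzWedhorn2020, Prop. 13.91] -/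
theorem isIrreducible_exc (S : StateA 𝔟 H ℬ 𝒟) (Γ : CentreA 𝔟 H ℬ Z) (hη : IsGenericPoint η (Z : Set W))
    (hτ : IsBlowup τ (vanishingIdeal Z)) : IsIrreducible ((((vanishingIdeal Z).comap τ).support : Set W')) := by
  rw [support_comap, Closeds.coe_preimage, Scheme.IdealSheafData.coe_support_vanishingIdeal]
  exact IsBlowup.isIrreducible_preimage_of_isRegular S.regW Γ.regZ Γ.irred (interior_piece_eq_empty S Γ hη) hτ

/-- **The support of the transported host**: `Supp τᶜ(H, m) = cl τ⁻¹(Supp H ∖ Z)` (res-D-pv-026's (L-A); `H` need not be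
reduced). [cite: BierstoneGrigorievMilmanWlodarczyk2011, §3.2] -/
theorem support_host' (S : StateA 𝔟 H ℬ 𝒟) (Γ : CentreA 𝔟 H ℬ Z) (hη : IsGenericPoint η (Z : Set W))
    (hτ : IsBlowup τ (vanishingIdeal Z)) (hm : idealOrder H η = m) :
    ((controlledTransform τ (vanishingIdeal Z) H m).support : Set W') = closure (τ ⁻¹' ((H.support : Set W) \ Z)) := by
  have P := S.pieceIn Γ hη
  rw [hτ.support_controlledTransform_eq_closure_of_mem_support S.regW Γ.regZ P.gen' (P.subZ P.η_mem) hm S.hostCartier,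
    Scheme.IdealSheafData.coe_support_vanishingIdeal]

/-- The strict transform of the host is its controlled transform with the generic order ((L-A)). [cite: Kollar2007, 3.30.2] -/
theorem strictTransform_host_eq (S : StateA 𝔟 H ℬ 𝒟) (Γ : CentreA 𝔟 H ℬ Z) (hη : IsGenericPoint η (Z : Set W))
    (hτ : IsBlowup τ (vanishingIdeal Z)) (hm : idealOrder H η = m) :
    strictTransformIdeal τ (vanishingIdeal Z) H = controlledTransform τ (vanishingIdeal Z) H m := by
  have P := S.pieceIn Γ hη
  exact hτ.strictTransformIdeal_eq_controlledTransform S.regW Γ.regZ P.gen'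
    (by rw [Scheme.IdealSheafData.coe_support_vanishingIdeal]; exact interior_piece_eq_empty S Γ hη) hm S.hostCartier

/-- The transported host is an effective Cartier divisor. [cite: Kollar2007, 3.30.2] -/
theorem hostCartier' (S : StateA 𝔟 H ℬ 𝒟) (Γ : CentreA 𝔟 H ℬ Z) (hη : IsGenericPoint η (Z : Set W))
    (hτ : IsBlowup τ (vanishingIdeal Z)) (hm : idealOrder H η = m) :
    IsEffectiveCartier (controlledTransform τ (vanishingIdeal Z) H m) :=
  hτ.isEffectiveCartier_controlledTransform_of_le_pow S.hostCartier ((S.pieceIn Γ hη).host_le_pow hm)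

omit [IsLocallyNoetherian W] in
/-- Points of the transported host lie over the host. [folklore] -/
theorem mem_support_of_mem_support_host' {x' : W'} (hx' : x' ∈ (controlledTransform τ (vanishingIdeal Z) H m).support) :
    τ x' ∈ H.support := by
  have h : x' ∈ ((H.comap τ).support : Set W') :=
    support_antitone (comap_le_controlledTransform τ (vanishingIdeal Z) H m) hx'
  exact (mem_support_comap_iff τ H x').mp h

/-- **Support form of «the transported host is not the exceptional divisor»** (`m` is the generic order, (L-A)).
[cite: Kollar2007, 3.30.2] -/
theorem free_exc (S : StateA 𝔟 H ℬ 𝒟) (Γ : CentreA 𝔟 H ℬ Z) (hη : IsGenericPoint η (Z : Set W))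
    (hτ : IsBlowup τ (vanishingIdeal Z)) (hm : idealOrder H η = m) :
    ¬ ((((vanishingIdeal Z).comap τ).support : Set W') ⊆ (controlledTransform τ (vanishingIdeal Z) H m).support) := by
  haveI : IsLocallyNoetherian W' := hτ.isLocallyNoetherian
  intro hsub
  set G := (vanishingIdeal Z).comap τ with hG
  obtain ⟨ξ, hξ⟩ := QuasiSober.sober (isIrreducible_exc S Γ hη hτ) G.support.isClosed
  have hξG : ξ ∈ (G.support : Set W') := hξ.mem
  have hGrad : vanishingIdeal G.support = G :=
    (Γ.sncZ.hasSNC_transform hτ).vanishingIdeal_support (List.mem_append_right _ (List.mem_singleton_self _))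
  have hGξ : stalkIdeal G ξ = maximalIdeal (W'.presheaf.stalk ξ) := by
    have hcl : G.support = ⟨closure {ξ}, isClosed_closure⟩ := Closeds.ext hξ.symm
    rw [← hGrad, hcl, stalkIdeal_vanishingIdeal_closure (specializes_refl ξ), primeOfSpecializes_refl]
  have hξD : stalkIdeal (controlledTransform τ (vanishingIdeal Z) H m) ξ ≤ stalkIdeal G ξ := by
    rw [hGξ]; exact (mem_support_iff_stalkIdeal_le _ ξ).mp (hsub hξG)
  have hτξ : τ ξ ∈ (Z : Set W) := by
    have h := (mem_support_comap_iff τ (vanishingIdeal Z) ξ).mp hξG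
    rwa [Scheme.IdealSheafData.coe_support_vanishingIdeal] at h
  exact hτ.not_stalkIdeal_controlledTransform_le_of_idealOrder_genericPoint_eq S.regW Γ.regZ hη
    (interior_piece_eq_empty S Γ hη) hm hτξ hξD

/-- **Support form of «the transported host contains no strict transform of a born trace»**. [cite: Kollar2007, 3.30.2] -/
theorem free_strict (S : StateA 𝔟 H ℬ 𝒟) (Γ : CentreA 𝔟 H ℬ Z) (hτ : IsBlowup τ (vanishingIdeal Z))
    (p : W.IdealSheafData × ℕ) (hp : p ∈ ℬ) :
    ¬ (((strictTransformIdeal τ (vanishingIdeal Z) p.1).support : Set W') ⊆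
      (controlledTransform τ (vanishingIdeal Z) H m).support) := by
  haveI : IsLocallyNoetherian W' := hτ.isLocallyNoetherian
  intro hsub
  refine S.free p hp fun y hy => ?_
  by_cases hyZ : y ∈ (Z : Set W)
  · exact Γ.subZ hyZ
  · have hyC : y ∉ ((vanishingIdeal Z).support : Set W) := by rwa [Scheme.IdealSheafData.coe_support_vanishingIdeal]
    obtain ⟨y', rfl⟩ := hτ.exists_eq_of_not_mem_support hyC
    have hy'E : y' ∉ ((vanishingIdeal Z).comap τ).support := fun h =>
      hyC ((mem_support_comap_iff τ (vanishingIdeal Z) y').mp h)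
    have hy'B : y' ∈ (strictTransformIdeal τ (vanishingIdeal Z) p.1).support :=
      (mem_support_strictTransformIdeal_iff_of_not_mem_exceptional τ (vanishingIdeal Z) p.1 hy'E).mpr hy
    exact mem_support_of_mem_support_host' (hsub hy'B)

/-! ## The traces side of the step -/

/-- The new traces have simple normal crossings. [cite: Kollar2007, Def. 3.25] -/
theorem sncB' (Γ : CentreA 𝔟 H ℬ Z) (hτ : IsBlowup τ (vanishingIdeal Z)) (e : ℕ) :
    HasSNC (boundaryOf (stepExp ℬ τ (vanishingIdeal Z) e)) := by
  rw [boundaryOf_stepExp]; exact Γ.sncZ.hasSNC_transform hτ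

/-- The new traces have irreducible supports. [cite: GortzWedhorn2020, Prop. 13.91] -/
theorem irred' (S : StateA 𝔟 H ℬ 𝒟) (Γ : CentreA 𝔟 H ℬ Z) (hη : IsGenericPoint η (Z : Set W))
    (hτ : IsBlowup τ (vanishingIdeal Z)) (e : ℕ) :
    ∀ p ∈ stepExp ℬ τ (vanishingIdeal Z) e, IsIrreducible (p.1.support : Set W') := by
  haveI : IsLocallyNoetherian W' := hτ.isLocallyNoetherian
  intro p hp
  rcases mem_stepExp_iff.mp hp with ⟨q, hq, rfl⟩ | rfl
  · refine isIrreducible_support_strictTransformIdeal hτ q.1 (S.irred q hq) ?_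
    rw [Scheme.IdealSheafData.coe_support_vanishingIdeal]
    exact S.not_support_subset_of_subset hq Γ.subZ
  · exact isIrreducible_exc S Γ hη hτ

/-- No new trace has its support inside the transported host. [cite: Kollar2007, 3.30.2] -/
theorem free' (S : StateA 𝔟 H ℬ 𝒟) (Γ : CentreA 𝔟 H ℬ Z) (hη : IsGenericPoint η (Z : Set W))
    (hτ : IsBlowup τ (vanishingIdeal Z)) (hm : idealOrder H η = m) (e : ℕ) :
    ∀ p ∈ stepExp ℬ τ (vanishingIdeal Z) e,
      ¬ ((p.1.support : Set W') ⊆ (controlledTransform τ (vanishingIdeal Z) H m).support) := by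
  intro p hp
  rcases mem_stepExp_iff.mp hp with ⟨q, hq, rfl⟩ | rfl
  · exact free_strict S Γ hτ q hq
  · exact free_exc S Γ hη hτ hm

/-- **Every new multiplicity is positive**: the old ones are kept, the new one is `m + w − 1 ≥ 1` by ORD2 at the generic point.
[cite: BierstoneGrigorievMilmanWlodarczyk2011, §4 Step 2a] -/
theorem pos' (S : StateA 𝔟 H ℬ 𝒟) (Γ : CentreA 𝔟 H ℬ Z) (hη : IsGenericPoint η (Z : Set W)) (hm : idealOrder H η = m)
    (hm1 : 1 ≤ m) :
    ∀ p ∈ stepExp ℬ τ (vanishingIdeal Z)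
        (m + weightOf ℬ (divisorsOver ℬ (vanishingIdeal Z) (vanishingIdeal Z).support) - 1), 1 ≤ p.2 := by
  intro p hp
  rcases mem_stepExp_iff.mp hp with ⟨q, hq, rfl⟩ | rfl
  · exact S.pos q hq
  · exact S.one_le_newExp Γ hη hm hm1

/-- The format's boundary law: the new N-exponent list lives on exactly the new traces. [folklore] -/
theorem bd' (S : StateA 𝔟 H ℬ 𝒟) (e e' : ℕ) :
    boundaryOf (stepExp 𝒟 τ (vanishingIdeal Z) e') = boundaryOf (stepExp ℬ τ (vanishingIdeal Z) e) := by
  rw [boundaryOf_stepExp, boundaryOf_stepExp, S.bd]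

/-- **The new factorisation** `τᶜ(𝔟, 1) = τᶜ(H, m) · monomialIdeal ℬ'`, `ℬ' = strict transforms ++ [(𝓘(Z)𝒪, m + w − 1)]`.
[cite: BierstoneGrigorievMilmanWlodarczyk2011, §4 Step 2a] [cite: Kollar2007, (3.111) Step 1] -/
theorem fac' (S : StateA 𝔟 H ℬ 𝒟) (Γ : CentreA 𝔟 H ℬ Z) (hη : IsGenericPoint η (Z : Set W))
    (hτ : IsBlowup τ (vanishingIdeal Z)) (hm : idealOrder H η = m) :
    controlledTransform τ (vanishingIdeal Z) 𝔟 1 =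
      controlledTransform τ (vanishingIdeal Z) H m *
        monomialIdeal (stepExp ℬ τ (vanishingIdeal Z)
          (m + weightOf ℬ (divisorsOver ℬ (vanishingIdeal Z) (vanishingIdeal Z).support) - 1)) := by
  have P := S.pieceIn Γ hη
  obtain ⟨m₀, hm₀, hm1⟩ := P.exists_idealOrder_host_eq
  obtain rfl : m = m₀ := by have := hm.symm.trans hm₀; exact_mod_cast this
  have h1 := hτ.comap_eq_pow_mul_controlledTransform_of_le_pow (S.le_centre_pow_one Γ)
  have hν : 1 ≤ m + weightAt ℬ η := by omega
  have h2 := comap_host_mul_monomialIdeal hη Γ.sncZ hτ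
    (hτ.comap_eq_pow_mul_controlledTransform_of_le_pow (P.host_le_pow hm)) hν
  rw [← S.fac, h1, ← weightOf_divisorsOver_single_eq_weightAt ℬ hη] at h2
  exact (hτ.isEffectiveCartier.pow 1).eq_of_mul_eq_mul h2

/-- **The new state.** [cite: BierstoneGrigorievMilmanWlodarczyk2011, Def. 3.1.3] [cite: Kollar2007, 3.30.2] -/
theorem stateA' (S : StateA 𝔟 H ℬ 𝒟) (Γ : CentreA 𝔟 H ℬ Z) (hη : IsGenericPoint η (Z : Set W))
    (hτ : IsBlowup τ (vanishingIdeal Z)) (hm : idealOrder H η = m) (e' : ℕ) :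
    @StateA W' hτ.isLocallyNoetherian (controlledTransform τ (vanishingIdeal Z) 𝔟 1)
      (controlledTransform τ (vanishingIdeal Z) H m)
      (stepExp ℬ τ (vanishingIdeal Z)
        (m + weightOf ℬ (divisorsOver ℬ (vanishingIdeal Z) (vanishingIdeal Z).support) - 1))
      (stepExp 𝒟 τ (vanishingIdeal Z) e') := by
  haveI : IsLocallyNoetherian W' := hτ.isLocallyNoetherian
  obtain ⟨m₀, hm₀, hm1⟩ := (S.pieceIn Γ hη).exists_idealOrder_host_eq
  obtain rfl : m = m₀ := by have := hm.symm.trans hm₀; exact_mod_cast this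
  exact { regW := hτ.isRegular_of_isRegular_subscheme S.regW Γ.regZ
          fac := fac' S Γ hη hτ hm
          hostCartier := hostCartier' S Γ hη hτ hm
          sncB := sncB' Γ hτ _
          irred := irred' S Γ hη hτ _
          free := free' S Γ hη hτ hm _
          pos := pos' S Γ hη hm hm1
          bd := bd' S _ _ }

/-- **The boundary cover**: a point of `W'` lying over a born trace or over the piece lies on a new trace (strict transform off
the exceptional divisor, exceptional divisor on it) — the E-side half of `B_{j+1} = τ⁻¹(B_j ∪ D_j)`.
[cite: CossartJannsenSaito2020, (6.2)] -/
theorem cover' (hτ : IsBlowup τ (vanishingIdeal Z)) (e : ℕ) {x' : W'}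
    (hx : (∃ p ∈ ℬ, τ x' ∈ p.1.support) ∨ τ x' ∈ (Z : Set W)) :
    ∃ p ∈ stepExp ℬ τ (vanishingIdeal Z) e, x' ∈ p.1.support := by
  haveI : IsLocallyNoetherian W' := hτ.isLocallyNoetherian
  by_cases hx'E : x' ∈ ((vanishingIdeal Z).comap τ).support
  · exact ⟨_, List.mem_append_right _ (List.mem_singleton_self _), hx'E⟩
  · have hxZ : τ x' ∉ (Z : Set W) := fun h => hx'E <| (mem_support_comap_iff τ (vanishingIdeal Z) x').mpr <| by
      rw [Scheme.IdealSheafData.coe_support_vanishingIdeal]; exact h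
    rcases hx with ⟨p, hp, hxp⟩ | h
    · refine ⟨(strictTransformIdeal τ (vanishingIdeal Z) p.1, p.2), List.mem_append_left _ ?_, ?_⟩
      · exact List.mem_map.mpr ⟨p, hp, rfl⟩
      · exact (mem_support_strictTransformIdeal_iff_of_not_mem_exceptional τ (vanishingIdeal Z) p.1 hx'E).mpr hxp
    · exact absurd h hxZ

/-! ## Transport of the centre data of a disjoint piece -/

/-- **The centre data of a DISJOINT piece survive the blow-up** (as data for the transported state on `τ⁻¹Z₂`), ORD2 included
(orders of the controlled transform off the centre are the old orders).
[cite: BierstoneGrigorievMilmanWlodarczyk2011, §4 Step 2b, Lemma 8.0.3] [cite: GortzWedhorn2020, Prop. 13.91 (3)] -/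
theorem CentreA.transport (Γ : CentreA 𝔟 H ℬ Z) (hτ : IsBlowup τ (vanishingIdeal Z)) {Z₂ : Closeds W}
    (Γ₂ : CentreA 𝔟 H ℬ Z₂) (hd : Disjoint (Z : Set W) Z₂) (e : ℕ) :
    @CentreA W' hτ.isLocallyNoetherian (controlledTransform τ (vanishingIdeal Z) 𝔟 1)
      (controlledTransform τ (vanishingIdeal Z) H m) (stepExp ℬ τ (vanishingIdeal Z) e) (Z₂.preimage τ.continuous) := by
  haveI : IsLocallyNoetherian W' := hτ.isLocallyNoetherian
  have hd' : Disjoint (Z₂ : Set W) ((vanishingIdeal Z).support : Set W) := by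
    rw [Scheme.IdealSheafData.coe_support_vanishingIdeal]; exact hd.symm
  have hdC : Disjoint ((vanishingIdeal Z).support : Set W) ((vanishingIdeal Z₂).support : Set W) := by
    rw [Scheme.IdealSheafData.coe_support_vanishingIdeal, Scheme.IdealSheafData.coe_support_vanishingIdeal]; exact hd
  have hcomap : (vanishingIdeal Z₂).comap τ = vanishingIdeal (Z₂.preimage τ.continuous) :=
    hτ.comap_vanishingIdeal_of_disjoint Z₂ hd'
  refine { irred := ?_, regZ := ?_, subZ := ?_, sncZ := ?_, ord2 := ?_ }
  · exact hτ.isIrreducible_preimage_of_disjoint Z₂ hd' Γ₂.irred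
  · exact hτ.isRegular_subscheme_vanishingIdeal_preimage Z₂ hd' Γ₂.regZ
  · intro y' hy'
    have hy : τ y' ∈ (Z₂ : Set W) := hy'
    refine hτ.closure_preimage_diff_subset_support_controlledTransform m (subset_closure ⟨Γ₂.subZ hy, ?_⟩)
    rw [Scheme.IdealSheafData.coe_support_vanishingIdeal]
    exact Set.disjoint_right.mp hd hy
  · have h := HasSNCWith.transform_comap_of_disjoint hτ Γ.sncZ Γ₂.sncZ hdC
    rwa [← boundaryOf_stepExp ℬ τ (vanishingIdeal Z) e, hcomap] at h
  · intro z' hz'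
    have hz : τ z' ∈ (Z₂ : Set W) := hz'
    have hzC : τ z' ∉ ((vanishingIdeal Z).support : Set W) := by
      rw [Scheme.IdealSheafData.coe_support_vanishingIdeal]; exact Set.disjoint_right.mp hd hz
    rw [hτ.idealOrder_controlledTransform_of_not_mem 𝔟 1 hzC]
    exact Γ₂.ord2 (τ z') hz

end Step

end SepCJS

end Summit.ResolutionOfSingularities.ResolutionOfSingularities.Theorems

end
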